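import Summits.Langlands.Langlands.Statement
import Summits.Langlands.Langlands.Theses.DyadicOddResidue
import Summits.Langlands.Langlands.Theorems.DyadicOddResidueOddPrimesRegularFMOfXZhang
import Literature.NumberTheory.GaloisRepresentations.SymplecticMultiplier
import Literature.NumberTheory.GaloisRepresentations.GSpValued
import HarnessLib

/-!
# Witness (F3 / BC5) for the rung `SymplecticOddRegularQ 2` of line `SymplecticOddRegularQ2`
# (crux `ReciprocityUpToIrreducibility`, item stmt-Langlands-14328; G4 ladder-down, generation 4)

The rung family `SymplecticOddRegularQ g` (VERBATIM the definition in `Lines/SymplecticOddRegularQ2.lean`)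
SPECIALISES at the floor parameter `g = 1` to the tree theorem
`Summit.Langlands.Langlands.Theorems.oddPrimesRegularFM_of_XZhang2024_tateTwist`
(`Theorems/DyadicOddResidueOddPrimesRegularFMOfXZhang.lean`; item `DyadicOddResidue.OddPrimesRegularFM`,
stmt-Langlands-18743): Fontaine–Mazur for `GL₂/ℚ` in the regular case at every odd prime — Kisin 2009,
Emerton 2011, Skinner–Wiles 1999, Hu–Tan 2015, Pan 2022 (JAMS 35, Thm. 1.0.4), X. Zhang 2024
(arXiv:2412.06812, Thm. 1.0.2), with Khare–Wintenberger — conditional on exactly the one named Literature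
fact `XZhang2024_fontaineMazurGL2_tateTwist`, carried as the hypothesis of the example; NO `sorry`.
The only conversion is the polarization clause: in rank 2 every `ρ` is symplectic with multiplier
`det ρ` (`FramedGaloisRep.isSymplecticWithMultiplierFun_two_det`, Darmon–Diamond–Taylor §2.1) and the
multiplier of a rank-2 similitude is unique (`FramedGaloisRep.isOdd_iff_multiplier`), so "symplectic with
an odd multiplier" is Serre's `det ρ(c) = -1` — both directions, `floor_iff`.
witness_regime: g = 1 (n = 2), F = ℚ, ℓ odd, ρ irreducible odd, de Rham with distinct Hodge–Tate weights.
S known there: the (B)-clause of S on exactly this cell IS the floor theorem (F9: literal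
specialisation); S as a whole is not known at n = 2 over ℚ (even ρ; ℓ = 2 residually dihedral; full
`Corresponds` at v = ℓ for every datum).  Calibration OUTSIDE S's known regime inside the rung g = 2:
the cell `ρ ≅ Sym³ σ` (σ odd regular rank 2, ℓ odd: symplectic with multiplier `(det σ)³`, odd) is
decided by the floor + Kim–Shahidi (Sym³ : GL₂ → GL₄ functorial, Annals 155 (2002) Thm. B), and the
cell `ρ ≅ σ ⊗ τ`-free induced/Yoshida-type endoscopic lifts `σ ⊕ σ'`-congruent regular ρ with big
image is decided by BCGP-type lifting only in the ordinary p-distinguished case — while (B) for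
regular `GSp₄`-type ρ over ℚ in general is open (BCGP 2025 p. 4: residual automorphy of big-image
`ρ̄ : Γ_ℚ → GSp₄(𝔽_p)` — "we do not know how to do this").
-/

noncomputable section

set_option linter.dupNamespace false

open scoped MatrixGroups Matrix NumberField Classical Polynomial
open Filter IsDedekindDomain Field Polynomial
open Literature.NumberTheory.Automorphic Literature.NumberTheory.GaloisRepresentations
open Literature.NumberTheory.PAdicHodge
open Summit.Langlands

namespace Summit.Langlands.Langlands.Cruxes.ReciprocityUpToIrreducibility.SymplecticOddRegularQ2.Special

/-- **The rung family** (dial = genus `g`, rank `2g`): clause (B) of the summit over `ℚ` restricted to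
the symplectic Fontaine–Mazur sector at odd `ℓ` — `ρ : Γ_ℚ → GL_{2g}(ℚ̄_ℓ)` irreducible, preserving a
non-degenerate alternating form up to a multiplier `μ` with `μ(c) = -1` at complex conjugation
(GSp-oddness, Boxer–Calegari–Gee–Pilloni 2021 §7.6), unramified a.e., de Rham at `ℓ` for the PINNED
Fontaine datum with pairwise distinct labelled Hodge–Tate weights — conclusion in a.e.-Satake form.
At `g = 1` it is (equivalent to, `floor_iff`) the tree item `DyadicOddResidue.OddPrimesRegularFM`
(every rank-2 `ρ` is symplectic with multiplier `det ρ`). -/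
def SymplecticOddRegularQ (g : ℕ) : Prop :=
  ∀ (ℓ : ℕ) [Fact ℓ.Prime], ℓ ≠ 2 →
    ∀ (ρ : Literature.NumberTheory.GaloisRepresentations.FramedGaloisRep ℚ (PadicAlgCl ℓ) (2 * g)),
      ρ.toGaloisRep.IsIrreducible →
      (∃ μ : Field.absoluteGaloisGroup ℚ → PadicAlgCl ℓ, ρ.IsSymplecticWithMultiplierFun μ ∧
        ∀ (φ : ℚ →+* ℝ) (c : Field.absoluteGaloisGroup ℚ),
          Literature.NumberTheory.GaloisRepresentations.IsComplexConjugation φ c → μ c = -1) →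
      (∀ᶠ v : IsDedekindDomain.HeightOneSpectrum (NumberField.RingOfIntegers ℚ) in Filter.cofinite,
        ρ.IsUnramifiedAt v) →
      (∀ (v : IsDedekindDomain.HeightOneSpectrum (NumberField.RingOfIntegers ℚ))
        (hv : ((ℓ : ℕ) : NumberField.RingOfIntegers ℚ) ∈ v.asIdeal),
        (Literature.NumberTheory.PAdicHodge.fontainePstAdicCompletion v ℓ hv).IsDeRhamFramed (ρ.toLocal v) ∧
        ∀ τ : v.adicCompletion ℚ →+* PadicAlgCl ℓ, Continuous τ →
          (ρ.labelledHodgeTateWeightsAt v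
            (Literature.NumberTheory.PAdicHodge.fontainePstAdicCompletion v ℓ hv).algebra
            (Literature.NumberTheory.PAdicHodge.fontainePstAdicCompletion v ℓ hv).𝔅 τ).Nodup) →
      ∀ (hcpt : Literature.NumberTheory.Automorphic.isCompact_glFiniteIntegralLevel (2 * g) ℚ)
        (ι : PadicAlgCl ℓ ≃+* ℂ),
        ∃ π : Literature.NumberTheory.Automorphic.CuspidalAutomorphicRepData (2 * g) ℚ hcpt,
          π.1.IsLAlgebraic ∧
          ∀ᶠ v : IsDedekindDomain.HeightOneSpectrum (NumberField.RingOfIntegers ℚ) in Filter.cofinite,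
            Summit.Langlands.SatakeFrobCompatibleAt ι π.1 ρ v

/-- **THE RUNG** (the filed statement): the family at genus `g = 2` — reciprocity (B) for regular,
odd, symplectic `ρ : Γ_ℚ → GL₄(ℚ̄_ℓ)` (`GSp₄`-type), `ℓ` odd. -/
def SymplecticOddRegularQ2 : Prop := SymplecticOddRegularQ 2

section Floor

/-- Over a characteristic-zero domain an antisymmetric matrix has zero diagonal. [folklore] -/
theorem diag_eq_zero_of_transpose_eq_neg {A : Type*} [CommRing A] [NoZeroDivisors A] [CharZero A]
    {m : ℕ} {J : Matrix (Fin m) (Fin m) A} (hJt : Jᵀ = -J) (i : Fin m) : J i i = 0 := by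
  have h := congrFun (congrFun hJt i) i
  simp only [Matrix.transpose_apply, Matrix.neg_apply] at h
  have h2 : (2 : A) * J i i = 0 := by linear_combination h
  rcases mul_eq_zero.mp h2 with h2 | h2
  · exact absurd h2 two_ne_zero
  · exact h2

/-- In rank `2` (`GSp₂ = GL₂`) GSp-oddness of the multiplier IS Serre's oddness `det ρ(c) = -1`.
[cite: BoxerEtAl2021, §7.6] [folklore] -/
theorem isOdd_of_symplectic_odd {ℓ : ℕ} [Fact ℓ.Prime]
    (ρ : Literature.NumberTheory.GaloisRepresentations.FramedGaloisRep ℚ (PadicAlgCl ℓ) 2)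
    (h : ∃ μ : Field.absoluteGaloisGroup ℚ → PadicAlgCl ℓ, ρ.IsSymplecticWithMultiplierFun μ ∧
      ∀ (φ : ℚ →+* ℝ) (c : Field.absoluteGaloisGroup ℚ),
        Literature.NumberTheory.GaloisRepresentations.IsComplexConjugation φ c → μ c = -1) :
    ρ.IsOdd := by
  obtain ⟨μ, ⟨J, hJt, hJu, hJ⟩, hμ⟩ := h
  exact (FramedGaloisRep.isOdd_iff_multiplier hJu.ne_zero hJt
    (fun i => diag_eq_zero_of_transpose_eq_neg hJt i) hJ (by decide)).mpr hμ

/-- Conversely Serre-odd rank-2 `ρ` is symplectic with the odd multiplier `det ρ`.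
[cite: DarmonDiamondTaylor1995, §2.1] -/
theorem symplectic_odd_of_isOdd {ℓ : ℕ} [Fact ℓ.Prime]
    (ρ : Literature.NumberTheory.GaloisRepresentations.FramedGaloisRep ℚ (PadicAlgCl ℓ) 2)
    (h : ρ.IsOdd) :
    ∃ μ : Field.absoluteGaloisGroup ℚ → PadicAlgCl ℓ, ρ.IsSymplecticWithMultiplierFun μ ∧
      ∀ (φ : ℚ →+* ℝ) (c : Field.absoluteGaloisGroup ℚ),
        Literature.NumberTheory.GaloisRepresentations.IsComplexConjugation φ c → μ c = -1 := by
  refine ⟨fun g => (ρ g).val.det, FramedGaloisRep.isSymplecticWithMultiplierFun_two_det ρ, ?_⟩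
  intro φ c hc
  have h1 := congrArg (fun u : (PadicAlgCl ℓ)ˣ => (u : PadicAlgCl ℓ)) (h φ c hc)
  simpa [Matrix.GeneralLinearGroup.val_det_apply] using h1

/-- **The floor of the ladder** (`g = 1`) from the tree theorem
`Theorems.oddPrimesRegularFM_of_XZhang2024_tateTwist` (item `DyadicOddResidue.OddPrimesRegularFM`).
[cite: XZhang2024FontaineMazurP3, Thm. 1.0.2] [cite: Pan2022, Thm. 1.0.4] [cite: Kisin2009] -/
theorem floor_one (hXZ : XZhang2024_fontaineMazurGL2_tateTwist) : SymplecticOddRegularQ 1 := by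
  intro ℓ _ hℓ ρ hirr hsymp hunr hdR hcpt ι
  exact Summit.Langlands.Langlands.Theorems.oddPrimesRegularFM_of_XZhang2024_tateTwist hXZ ℓ hℓ ρ hirr
    (isOdd_of_symplectic_odd ρ hsymp) hunr hdR hcpt ι

/-- **F1 literalness**: at the floor parameter the family IS the floor item (both directions). -/
theorem floor_iff :
    SymplecticOddRegularQ 1 ↔ Summit.Langlands.Langlands.Theses.DyadicOddResidue.OddPrimesRegularFM := by
  constructor
  · intro h ℓ _ hℓ ρ hirr hodd hunr hdR hcpt ι
    exact h ℓ hℓ ρ hirr (symplectic_odd_of_isOdd ρ hodd) hunr hdR hcpt ι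
  · intro h ℓ _ hℓ ρ hirr hsymp hunr hdR hcpt ι
    exact h ℓ hℓ ρ hirr (isOdd_of_symplectic_odd ρ hsymp) hunr hdR hcpt ι

end Floor

/-- **F3 special-case instance**: the family at the floor parameter `g = 1` IS the floor. -/
example (hXZ : XZhang2024_fontaineMazurGL2_tateTwist) : SymplecticOddRegularQ 1 := by
  simpa [SymplecticOddRegularQ] using floor_one hXZ

end Summit.Langlands.Langlands.Cruxes.ReciprocityUpToIrreducibility.SymplecticOddRegularQ2.Special

end
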